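import Summits.KontsevichZagierPeriods.Zeta5Search.TwoTaleP15LineBoundDecay
import Summits.KontsevichZagierPeriods.Zeta5Search.TwoTaleRungAStripShift
import Summits.KontsevichZagierPeriods.Zeta5Search.TwoTaleRungALineRate

/-!
# Rung A `(6,5,4,7 | 0,1,2,12)`: `DecayA c` from a one-variable certificate

HONEST FRAMING: systematic search; no irrationality claim unless certified.  Cell pub-zeta5, class `measure`
(fam-measure g4), T3/T4.  No measure or irrationality claim is made here: this is the rung-A clone of P1 g9's
`TwoTaleP15LineBoundDecay` (p252335) — the `dy`-assembly.  With `TwoTaleRungAStripShift.decayA_of_halfLineBound`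
(line representation + strip shift PROVED at rung A) and the scaled line bound `TwoTaleRungALine.log_norm_RCA_line_le`,
the decay input `Denom.TwoTaleR3Forms.DecayA c` of Zudilin's Remark-3 rung follows from ONE explicit inequality for
the elementary function `rateA`:

* `lineIntegrandA_le` — pointwise on the line `x = ⌊23n/10⌋ + ½`, for `y ≠ 0`, `n ≥ 3`:
  `‖Rₙ(uₙ+iy)‖/cosh²(πy) ≤ 4e^{K0A}·n²·(484+y²)⁹·e^{nM}·e^{−δ|y|}` whenever `rateA η − (2π−δ)|η| ≤ M` for all `η ≠ 0`;
* `integral_lineIntegrandA_le` — integrated against P1's integrable majorant `(484+y²)⁹e^{−δ|y|}`;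
* **`decayA_of_certificate`**: `0 < δ` → `(∀ η ≠ 0, rateA η − (2π − δ)|η| ≤ M)` → `c < −M` → `DecayA c`.
The certificate itself (numerically `sup_η (rateA η − 2π|η|) = −13.22912` at `η ≈ ±0.9263`) is fam-denom g7's
`Denom.RungALineCertificate.certA_delta`; the final assembly is `TwoTaleRungADecayHolds`.
References: W. Zudilin, arXiv:1310.1526 [Zudilin2014ZetaTwo] Prop. 1, Lemma 6, Remark 3.
-/

noncomputable section

open Real Complex MeasureTheory Set Filter
open Literature.NumberTheory.Irrationality.Zudilin2014
open Summit.KontsevichZagierPeriods.Zeta5Search.Denom.TwoTaleR3Forms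
open Summit.KontsevichZagierPeriods.Zeta5Search.TwoTaleLineBound
open Summit.KontsevichZagierPeriods.Zeta5Search.TwoTaleRungADecay (ratRCA)
open Summit.KontsevichZagierPeriods.Zeta5Search.TwoTaleRungAStripShift (decayA_of_halfLineBound)

namespace Summit.KontsevichZagierPeriods.Zeta5Search.TwoTaleRungALine

variable {M δ : ℝ}

/-- **Pointwise bound on the line** (`y ≠ 0`, `n ≥ 3`), given the certificate with slope `2π − δ`. -/
theorem lineIntegrandA_le (hcert : ∀ η : ℝ, η ≠ 0 → rateA η - (2 * π - δ) * |η| ≤ M) {n : ℕ} (hn : 3 ≤ n)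
    {y : ℝ} (hy : y ≠ 0) :
    ‖ratRCA n ((uLineA n : ℂ) + (y : ℂ) * I)‖ / Real.cosh (π * y) ^ 2 ≤
      4 * Real.exp K0A * (n : ℝ) ^ 2 * (484 + y ^ 2) ^ 9 * Real.exp (n * M) * Real.exp (-(δ * |y|)) := by
  have hn0 : (0 : ℝ) < n := by exact_mod_cast (show 0 < n by omega)
  have hn1 : (1 : ℝ) ≤ n := by exact_mod_cast (show 1 ≤ n by omega)
  obtain ⟨η, hη⟩ : ∃ η : ℝ, η = y / n := ⟨_, rfl⟩
  have hη0 : η ≠ 0 := by rw [hη]; exact div_ne_zero hy hn0.ne'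
  have hyη : (n : ℝ) * η = y := by rw [hη]; field_simp
  have hL : Real.log ‖ratRCA n ((uLineA n : ℂ) + (y : ℂ) * I)‖ ≤
      n * rateA η + 2 * Real.log n + 9 * Real.log (22 ^ 2 + η ^ 2) + K0A := by
    have h := log_norm_RCA_line_le hη0 hn
    rw [show ((((n : ℝ) * η : ℝ) : ℂ)) = (y : ℂ) by rw [hyη]] at h
    exact h
  have hc := hcert η hη0
  -- scale the certificate: n·rateA η ≤ n M + (2π − δ)|y|
  have habs : (n : ℝ) * |η| = |y| := by rw [← abs_of_pos hn0, ← abs_mul, hyη]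
  have hc' : (n : ℝ) * rateA η ≤ n * M + (2 * π - δ) * |y| :=
    calc (n : ℝ) * rateA η = n * (rateA η - (2 * π - δ) * |η|) + (2 * π - δ) * (n * |η|) := by ring
      _ ≤ n * M + (2 * π - δ) * (n * |η|) := by gcongr
      _ = n * M + (2 * π - δ) * |y| := by rw [habs]
  -- (y/n)² ≤ y²
  have hlog : Real.log (22 ^ 2 + η ^ 2) ≤ Real.log (484 + y ^ 2) := by
    apply Real.log_le_log (by positivity)
    have : η ^ 2 ≤ y ^ 2 := by
      rw [hη, div_pow]; exact div_le_self (sq_nonneg y) (by nlinarith)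
    nlinarith
  -- log of the numerator
  have hlogR : Real.log ‖ratRCA n ((uLineA n : ℂ) + (y : ℂ) * I)‖ ≤
      n * M + (2 * π - δ) * |y| + 2 * Real.log n + 9 * Real.log (484 + y ^ 2) + K0A := by
    refine hL.trans ?_
    have h9 := mul_le_mul_of_nonneg_left hlog (by norm_num : (0:ℝ) ≤ 9)
    exact add_le_add (add_le_add (add_le_add hc' le_rfl) h9) le_rfl
  have hR : ‖ratRCA n ((uLineA n : ℂ) + (y : ℂ) * I)‖ ≤
      Real.exp (n * M + (2 * π - δ) * |y| + 2 * Real.log n + 9 * Real.log (484 + y ^ 2) + K0A) := by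
    rcases eq_or_lt_of_le (norm_nonneg (ratRCA n ((uLineA n : ℂ) + (y : ℂ) * I))) with h0 | hpos
    · rw [← h0]; exact (Real.exp_pos _).le
    · exact (Real.log_le_iff_le_exp hpos).1 hlogR
  -- the kernel
  have hK : Real.exp (2 * |π * y|) / 4 ≤ Real.cosh (π * y) ^ 2 := exp_le_cosh_sq _
  have hcosh : 0 < Real.cosh (π * y) ^ 2 := by positivity
  rw [div_le_iff₀ hcosh]
  have hpy : |π * y| = π * |y| := by rw [abs_mul, abs_of_pos Real.pi_pos]
  rw [hpy] at hK
  have hexp : Real.exp (n * M + (2 * π - δ) * |y| + 2 * Real.log n + 9 * Real.log (484 + y ^ 2) + K0A) =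
      Real.exp K0A * (n : ℝ) ^ 2 * (484 + y ^ 2) ^ 9 * Real.exp (n * M) * Real.exp (-(δ * |y|))
        * (Real.exp (2 * (π * |y|)) / 4) * 4 := by
    rw [show n * M + (2 * π - δ) * |y| + 2 * Real.log n + 9 * Real.log (484 + y ^ 2) + K0A =
      K0A + 2 * Real.log n + 9 * Real.log (484 + y ^ 2) + n * M + (-(δ * |y|)) + 2 * (π * |y|) by ring]
    rw [Real.exp_add, Real.exp_add, Real.exp_add, Real.exp_add, Real.exp_add]
    rw [show (2 : ℝ) * Real.log n = Real.log ((n : ℝ) ^ 2) by rw [Real.log_pow]; push_cast; ring,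
      Real.exp_log (by positivity),
      show (9 : ℝ) * Real.log (484 + y ^ 2) = Real.log ((484 + y ^ 2) ^ 9) by rw [Real.log_pow]; push_cast; ring,
      Real.exp_log (by positivity)]
    ring
  calc ‖ratRCA n ((uLineA n : ℂ) + (y : ℂ) * I)‖
      ≤ Real.exp K0A * (n : ℝ) ^ 2 * (484 + y ^ 2) ^ 9 * Real.exp (n * M) * Real.exp (-(δ * |y|))
          * (Real.exp (2 * (π * |y|)) / 4) * 4 := by rw [← hexp]; exact hR
    _ ≤ Real.exp K0A * (n : ℝ) ^ 2 * (484 + y ^ 2) ^ 9 * Real.exp (n * M) * Real.exp (-(δ * |y|))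
          * Real.cosh (π * y) ^ 2 * 4 := by gcongr
    _ = 4 * Real.exp K0A * (n : ℝ) ^ 2 * (484 + y ^ 2) ^ 9 * Real.exp (n * M) * Real.exp (-(δ * |y|))
          * Real.cosh (π * y) ^ 2 := by ring

/-- The integral of the majorant: `∫ Fₙ ≤ 4e^{K0A} n² e^{nM} · ∫ (484+y²)⁹e^{−δ|y|}` (`n ≥ 3`). -/
theorem integral_lineIntegrandA_le (hδ : 0 < δ) (hcert : ∀ η : ℝ, η ≠ 0 → rateA η - (2 * π - δ) * |η| ≤ M)
    {n : ℕ} (hn : 3 ≤ n) :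
    ∫ y : ℝ, ‖ratRCA n ((uLineA n : ℂ) + (y : ℂ) * I)‖ / Real.cosh (π * y) ^ 2 ≤
      4 * Real.exp K0A * (n : ℝ) ^ 2 * Real.exp (n * M) * ∫ y : ℝ, (484 + y ^ 2) ^ 9 * Real.exp (-(δ * |y|)) := by
  rw [← integral_const_mul]
  refine integral_mono_of_nonneg (Filter.Eventually.of_forall fun y => by positivity)
    ((integrable_poly_exp hδ).const_mul _) ?_
  have h0 : ∀ᵐ y : ℝ ∂volume, y ≠ 0 := by
    have : (volume : Measure ℝ) {0} = 0 := measure_singleton 0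
    filter_upwards [measure_eq_zero_iff_ae_notMem.1 this] with y hy
    simpa using hy
  filter_upwards [h0] with y hy
  have := lineIntegrandA_le hcert hn hy
  calc ‖ratRCA n ((uLineA n : ℂ) + (y : ℂ) * I)‖ / Real.cosh (π * y) ^ 2
      ≤ 4 * Real.exp K0A * (n : ℝ) ^ 2 * (484 + y ^ 2) ^ 9 * Real.exp (n * M) * Real.exp (-(δ * |y|)) := this
    _ = 4 * Real.exp K0A * (n : ℝ) ^ 2 * Real.exp (n * M) * ((484 + y ^ 2) ^ 9 * Real.exp (-(δ * |y|))) := by ring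

/-- **`DecayA c` from the certificate**: if for some `δ > 0` and `M` the explicit rate function satisfies
`rateA η − (2π − δ)|η| ≤ M` for all `η ≠ 0`, then `DecayA c` holds for every `c < −M`
(line representation, strip shift, line bound and `dy`-assembly all PROVED; only the one-variable inequality is an
input — fam-denom g7's `Denom.RungALineCertificate.certA_delta` supplies it with `M = −13.22912 + 6δ`). -/
theorem decayA_of_certificate (hδ : 0 < δ) (hcert : ∀ η : ℝ, η ≠ 0 → rateA η - (2 * π - δ) * |η| ≤ M) {c : ℝ}
    (hc : c < -M) : DecayA c := by
  refine decayA_of_halfLineBound xLineA xLineA_le ?_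
  set ε : ℝ := -M - c with hεdef
  have hε : 0 < ε := by rw [hεdef]; linarith
  set A : ℝ := 4 * Real.exp K0A * ∫ y : ℝ, (484 + y ^ 2) ^ 9 * Real.exp (-(δ * |y|)) with hA
  have hA0 : 0 ≤ A := by
    rw [hA]; exact mul_nonneg (by positivity) (integral_nonneg fun y => by positivity)
  -- eventually: (π/2)·A·(8/ε²) ≤ e^{εn/2}
  have hev : ∀ᶠ n : ℕ in atTop, π / 2 * A * (8 / ε ^ 2) ≤ Real.exp (ε / 2 * n) := by
    have ht : Tendsto (fun n : ℕ => Real.exp (ε / 2 * n)) atTop atTop :=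
      Real.tendsto_exp_atTop.comp (tendsto_natCast_atTop_atTop.const_mul_atTop (by positivity))
    exact ht.eventually_ge_atTop _
  have hev3 : ∀ᶠ n : ℕ in atTop, 3 ≤ n := Filter.eventually_ge_atTop 3
  filter_upwards [hev, hev3] with n hK hn3
  have hn0 : (0 : ℝ) < n := by exact_mod_cast (show 0 < n by omega)
  -- rewrite the integrand's argument to `uLineA n + y I`
  have harg : ∀ y : ℝ, ((((xLineA n : ℝ) + 1 / 2 : ℝ) : ℂ) - (5 * n + 1) + (y : ℂ) * I) =
      ((uLineA n : ℂ) + (y : ℂ) * I) := fun y => by unfold uLineA; push_cast; ring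
  simp_rw [harg]
  have hI := integral_lineIntegrandA_le hδ hcert hn3
  have hsq := sq_le_exp hε n
  have hpi : 0 < π / 2 := by positivity
  calc π / 2 * ∫ y : ℝ, ‖ratRCA n ((uLineA n : ℂ) + (y : ℂ) * I)‖ / Real.cosh (π * y) ^ 2
      ≤ π / 2 * (4 * Real.exp K0A * (n : ℝ) ^ 2 * Real.exp (n * M) *
          ∫ y : ℝ, (484 + y ^ 2) ^ 9 * Real.exp (-(δ * |y|))) := mul_le_mul_of_nonneg_left hI hpi.le
    _ = π / 2 * A * (n : ℝ) ^ 2 * Real.exp (n * M) := by rw [hA]; ring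
    _ ≤ π / 2 * A * (8 / ε ^ 2 * Real.exp (ε / 2 * n)) * Real.exp (n * M) := by gcongr
    _ = (π / 2 * A * (8 / ε ^ 2)) * Real.exp (ε / 2 * n) * Real.exp (n * M) := by ring
    _ ≤ Real.exp (ε / 2 * n) * Real.exp (ε / 2 * n) * Real.exp (n * M) := by gcongr
    _ = Real.exp (-(c * n)) := by
        rw [← Real.exp_add, ← Real.exp_add]; congr 1; rw [hεdef]; ring

end Summit.KontsevichZagierPeriods.Zeta5Search.TwoTaleRungALine

end
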